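import Literature.NumberTheory.LFunctions.ChebyshevSylvesterPrimeWindows
import Mathlib.Data.Nat.Factors
import Mathlib.Data.Nat.Factorization.Basic
import Mathlib.Data.Nat.ModEq
import Mathlib.Tactic.NormNum.Prime
import HarnessLib

/-!
# Khare–Wintenberger, *Serre's modularity conjecture (I)*, §7: the estimates on primes

Topic `Literature/NumberTheory/Automorphic` (companion of `SerreConjecture.lean`, whose named fact
`khare_wintenberger` is Serre's conjecture as proved by Khare–Wintenberger and Kisin).  This is a
pure proof file: it formalizes, sorry-free and without any new named fact, the elementary
prime-number input of the weight-reduction step of the proof (Khare–Wintenberger (I), Invent. Math.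
178 (2009), §7 "Estimates on primes" and its use in §8.2, "The inductive step").

## The printed statement (op. cit. §7)

> In the arguments below we need to check, that for each prime `p ≥ 5`, there is a prime `P > p`
> (for instance the next prime after `p`) and either
> (i) an odd prime power divisor `ℓ^r ∥ (P − 1)` so that
>   `P/p ≤ (2m+1)/(m+1) − (m/(m+1)) (1/p)`                                          (1)
> where we have set `ℓ = 2m + 1` with `m ≥ 1`, or
> (ii) `2^r ∥ (P − 1)` (with `r ≥ 4`) so that
>   `P/p ≤ 2^r/(2^{r−1}+2) − ((2^{r−1} − 2)/(2^{r−1}+2)) (1/p)`.                     (2)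
> […] For later reference we note that it follows from (1) that
>   `p + 1 ≥ ((m+1)/(2m+1)) (P − 1) + 2 = (P + 1) − (m/(2m+1)) (P − 1)`,             (3)
> and it follows from (2) that
>   `p + 1 ≥ ((2^{r−1}+2)/2^r) (P − 1) + 2 ≥ (P + 1) − (1/2) (P − 1)`.               (4)

Khare–Wintenberger check this "by hand for `p ≤ 31`" and for `p > 31` from the Rosser–Schoenfeld
estimates (their [23]), via `P/p ≤ 3/2 − 1/30`.  In §8.2 (inductive step, residue characteristic
`P` = the next prime after `p ≥ 5`) it is used as follows: one chooses `χ' = ω_P^i` with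
`i ∈ [ (m/(2m+1))(P−1), ((m+1)/(2m+1))(P−1) ]` when `ℓ > 2`, and an even
`i ∈ [ (1/2)(P−1), ((2^{r−1}+2)/2^r)(P−1) ]` when `ℓ = 2`, reducing to a prescribed character, and
"by choice of `i`, the estimates (3) and (4) of Section 7, and Theorem 5.1 (3)" (which gives Serre
weight `i + 2` or `P + 1 − i`) one gets a weight `≤ p + 1`.

## What is here (all proved)

* `exists_prime_gt_and_two_mul_le` — for every `n ≥ 8` there is a prime `q` with
  `n < q ≤ (3n − 1)/2`.  For `n ≥ 33` this is the tree's explicit Chebyshev–Sylvester window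
  `Literature.NumberTheory.LFunctions.exists_prime_Ioc_sylvester` (a prime in `(x, 1.15 x]`,
  `x ≥ 33`), which replaces the appeal to Rosser–Schoenfeld; below `33` an explicit list.
* `sec7_of_two_mul_le` — the integer-cleared forms (3)/(4) of (1)/(2) for ANY prime `P > p ≥ 5`
  with `2P ≤ 3p − 1`: if `P − 1` has an odd prime factor `ℓ = 2m+1`, `ℓ^r ∥ P − 1`, then
  `(m+1)(P−1) + 2(2m+1) ≤ (2m+1)(p+1)`; otherwise `P − 1 = 2^r` with `r ≥ 4` and
  `(2^{r−1}+2)(P−1) + 2^{r+1} ≤ 2^r (p+1)`.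
* `sec7` — **§7 as printed**: for every prime `p ≥ 5`, with `P` THE NEXT prime after `p`
  (characterised inside the statement as the least prime `> p`), alternative (1) or (2) holds, the
  inequalities being stated over `ℚ` exactly as printed; `sec7_int` is the same with the
  integer forms (3)/(4).  (`p = 7`, `P = 11` is the one case not covered by `2P ≤ 3p − 1`; there
  `ℓ = 5` gives equality in (1), as does `ℓ = 3` for `p = 5`, `P = 7`.)
* `ineq3_of_ineq1`, `ineq4_of_ineq2`, `ineq3_identity`, `ineq4_weak` — the passages (1) ⇒ (3),
  (2) ⇒ (4) and the two elementary (in)equalities printed in (3) and (4).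
* The §8.2 choice of the exponent `i` (an `i` of prescribed residue class modulo `(P−1)/ℓ^r`,
  even for `ℓ = 2`, in the printed interval, whence both candidate weights are `≤ p + 1`) is the
  companion file `KhareWintenbergerExponentChoice.lean`.

Nothing else of Khare–Wintenberger's argument is formalized here (Theorems 3.1–3.4, 4.1, 5.1 and
Lemmas 6.1–6.3, 8.2 involve modularity lifting, compatible systems and Dickson's theorem).

## References

* C. Khare, J.-P. Wintenberger, *Serre's modularity conjecture (I)*, Invent. Math. 178 (2009),
  485–504, §7 (estimates (1)–(4)) and §8.2 (choice of `i`).  [KhareWintenberger2009]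
* C. Khare, *Serre's modularity conjecture: the level one case*, Duke Math. J. 134 (2006) — the
  source of the estimates, cited as [14] in op. cit.  [Khare2006]
-/

namespace Literature.NumberTheory.Automorphic.KhareWintenberger

open Nat

/-! ### Primes in `(n, (3n−1)/2]` -/

/-- For every natural number `n ≥ 33` there is a prime `q` with `n < q` and `2q ≤ 3n − 1`; from the
tree's Chebyshev–Sylvester window (a prime in `(x, 23x/20]` for real `x ≥ 33`), since
`23n/10 ≤ 3n − 1` for `n ≥ 2`. [folklore] -/
theorem exists_prime_gt_and_two_mul_le_of_le {n : ℕ} (hn : 33 ≤ n) :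
    ∃ q : ℕ, q.Prime ∧ n < q ∧ 2 * q ≤ 3 * n - 1 := by
  obtain ⟨q, hq, hnq, hqle⟩ :=
    LFunctions.exists_prime_Ioc_sylvester (x := (n : ℝ)) (by exact_mod_cast hn)
  refine ⟨q, hq, by exact_mod_cast hnq, ?_⟩
  have hn' : (33 : ℝ) ≤ n := by exact_mod_cast hn
  have h1 : ((2 * q : ℕ) : ℝ) ≤ ((3 * n - 1 : ℕ) : ℝ) := by
    rw [Nat.cast_sub (by omega)]
    push_cast
    linarith
  exact_mod_cast h1

/-- For every natural number `n ≥ 8` there is a prime `q` with `n < q` and `2q ≤ 3n − 1`, i.e.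
`n < q ≤ (3n − 1)/2` (false for `n = 7`).  Below `33` by the explicit primes
`11, 13, 17, 19, 23, 29, 31, 37`; from `33` on by `exists_prime_gt_and_two_mul_le_of_le`. [folklore] -/
theorem exists_prime_gt_and_two_mul_le {n : ℕ} (hn : 8 ≤ n) :
    ∃ q : ℕ, q.Prime ∧ n < q ∧ 2 * q ≤ 3 * n - 1 := by
  rcases le_or_gt 33 n with h | h
  · exact exists_prime_gt_and_two_mul_le_of_le h
  · have key : ∀ k ∈ Finset.Ico 8 33, ∃ q ∈ ({11, 13, 17, 19, 23, 29, 31, 37} : Finset ℕ),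
        k < q ∧ 2 * q ≤ 3 * k - 1 := by
      decide
    have hprime : ∀ q ∈ ({11, 13, 17, 19, 23, 29, 31, 37} : Finset ℕ), q.Prime := by
      intro q hq
      simp only [Finset.mem_insert, Finset.mem_singleton] at hq
      rcases hq with rfl | rfl | rfl | rfl | rfl | rfl | rfl | rfl <;> norm_num
    obtain ⟨q, hq, h1, h2⟩ := key n (Finset.mem_Ico.2 ⟨hn, h⟩)
    exact ⟨q, hprime q hq, h1, h2⟩

/-- The next prime after `n ≥ 8` is at most `(3n − 1)/2`: there is a prime `P > n`, least among the
primes `> n`, with `2P ≤ 3n − 1`. [folklore] -/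
theorem exists_nextPrime_two_mul_le {n : ℕ} (hn : 8 ≤ n) :
    ∃ P : ℕ, P.Prime ∧ n < P ∧ (∀ q : ℕ, q.Prime → n < q → P ≤ q) ∧ 2 * P ≤ 3 * n - 1 := by
  classical
  have hex : ∃ P : ℕ, n < P ∧ P.Prime := by
    obtain ⟨q, hq, hnq, -⟩ := exists_prime_gt_and_two_mul_le hn
    exact ⟨q, hnq, hq⟩
  obtain ⟨q, hq, hnq, hqle⟩ := exists_prime_gt_and_two_mul_le hn
  refine ⟨Nat.find hex, (Nat.find_spec hex).2, (Nat.find_spec hex).1,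
    fun q' hq' hnq' => Nat.find_min' hex ⟨hnq', hq'⟩, ?_⟩
  have : Nat.find hex ≤ q := Nat.find_min' hex ⟨hnq, hq⟩
  omega

/-! ### The integer forms (3), (4) for any prime `P ∈ (p, (3p−1)/2]` -/

/-- **Khare–Wintenberger (I), §7, estimates (1)/(3) and (2)/(4), integer-cleared, for any prime
`P` with `p < P` and `2P ≤ 3p − 1` (`p ≥ 5`).**  Either `P − 1` has an odd prime divisor
`ℓ = 2m + 1` (`m ≥ 1`), and then with `ℓ^r ∥ P − 1` (`r ≥ 1`) estimate (3) = (1) holds: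
`(m+1)(P−1) + 2(2m+1) ≤ (2m+1)(p+1)`; or `P − 1 = 2^r` is a power of two, and then `r ≥ 4`,
`2^r ∥ P − 1` and estimate (4) = (2) holds: `(2^{r−1}+2)(P−1) + 2^{r+1} ≤ 2^r (p+1)`.
Proof: `2(P−1) ≤ 3(p−1)` and `(m+1)·3/2 ≤ 2m+1`, resp. `(2^{r−1}+2)·3/2 ≤ 2^r` for `r ≥ 4`
(`P = 2^r + 1 > 5` prime forces `r ≥ 4`).
[cite: KhareWintenberger2009, §7, (1)–(4)] -/
theorem sec7_of_two_mul_le {p P : ℕ} (hp : 5 ≤ p) (hP : P.Prime) (hpP : p < P)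
    (hle : 2 * P ≤ 3 * p - 1) :
    (∃ ℓ m r : ℕ, ℓ.Prime ∧ ℓ = 2 * m + 1 ∧ 1 ≤ m ∧ 1 ≤ r ∧ ℓ ^ r ∣ P - 1 ∧ ¬ ℓ ^ (r + 1) ∣ P - 1 ∧
        (m + 1) * (P - 1) + 2 * (2 * m + 1) ≤ (2 * m + 1) * (p + 1)) ∨
      (∃ r : ℕ, 4 ≤ r ∧ P - 1 = 2 ^ r ∧ 2 ^ r ∣ P - 1 ∧ ¬ 2 ^ (r + 1) ∣ P - 1 ∧
        (2 ^ (r - 1) + 2) * (P - 1) + 2 ^ (r + 1) ≤ 2 ^ r * (p + 1)) := by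
  -- `a = P - 1`, `b = p - 1`, `2a ≤ 3b`.
  obtain ⟨a, rfl⟩ : ∃ a, P = a + 1 := ⟨P - 1, by omega⟩
  obtain ⟨b, rfl⟩ : ∃ b, p = b + 1 := ⟨p - 1, by omega⟩
  simp only [Nat.add_sub_cancel] at *
  have hab : 2 * a ≤ 3 * b := by omega
  have ha0 : a ≠ 0 := by omega
  rcases Nat.eq_two_pow_or_exists_odd_prime_and_dvd a with ⟨k, hk⟩ | ⟨ℓ, hℓ, hℓa, hodd⟩
  · -- `P - 1 = 2^k`, a Fermat prime `> 5`, so `k ≥ 4`.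
    right
    have hk4 : 4 ≤ k := by
      by_contra hlt
      push Not at hlt
      interval_cases k
      · norm_num at hk; omega
      · norm_num at hk; omega
      · norm_num at hk; omega
      · norm_num at hk; subst hk; exact absurd hP (by norm_num)
    refine ⟨k, hk4, hk, hk ▸ dvd_rfl, ?_, ?_⟩
    · rw [hk, Nat.pow_dvd_pow_iff_le_right (by norm_num)]
      omega
    · -- `(2^(k-1)+2) a ≤ 2^k b` from `2a ≤ 3b` and `6 ≤ 2^(k-1)`.
      obtain ⟨j, rfl⟩ : ∃ j, k = j + 1 := ⟨k - 1, by omega⟩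
      simp only [Nat.add_sub_cancel]
      have hj : 8 ≤ 2 ^ j := by
        calc (8 : ℕ) = 2 ^ 3 := by norm_num
          _ ≤ 2 ^ j := Nat.pow_le_pow_right (by norm_num) (by omega)
      have h2 : 2 ^ (j + 1) = 2 * 2 ^ j := by rw [pow_succ]; ring
      have h3 : 2 ^ (j + 1 + 1) = 4 * 2 ^ j := by rw [pow_succ, pow_succ]; ring
      rw [h2, h3]
      -- goal: (2^j + 2) * a + 4 * 2^j ≤ 2 * 2^j * (b + 2)
      have key : 2 * ((2 ^ j + 2) * a) ≤ 2 * (2 * 2 ^ j * b) := by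
        calc 2 * ((2 ^ j + 2) * a) = (2 ^ j + 2) * (2 * a) := by ring
          _ ≤ (2 ^ j + 2) * (3 * b) := Nat.mul_le_mul_left _ hab
          _ = (3 * 2 ^ j + 6) * b := by ring
          _ ≤ (4 * 2 ^ j) * b := Nat.mul_le_mul_right _ (by omega)
          _ = 2 * (2 * 2 ^ j * b) := by ring
      have key' : (2 ^ j + 2) * a ≤ 2 * 2 ^ j * b := Nat.le_of_mul_le_mul_left key (by norm_num)
      nlinarith [key']
  · -- `ℓ = 2m+1` an odd prime factor of `P - 1`.
    left
    obtain ⟨m, rfl⟩ : ∃ m, ℓ = 2 * m + 1 := hodd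
    have hm : 1 ≤ m := by
      rcases m with _ | m
      · exact absurd hℓ (by norm_num)
      · omega
    refine ⟨2 * m + 1, m, a.factorization (2 * m + 1), hℓ, rfl, hm, ?_, Nat.ordProj_dvd a _,
      Nat.pow_succ_factorization_not_dvd ha0 hℓ, ?_⟩
    · exact hℓ.factorization_pos_of_dvd ha0 hℓa
    · -- `(m+1) a ≤ (2m+1) b` from `2a ≤ 3b` and `3(m+1) ≤ 2(2m+1)`.
      have key : 2 * ((m + 1) * a) ≤ 2 * ((2 * m + 1) * b) := by
        calc 2 * ((m + 1) * a) = (m + 1) * (2 * a) := by ring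
          _ ≤ (m + 1) * (3 * b) := Nat.mul_le_mul_left _ hab
          _ = (3 * m + 3) * b := by ring
          _ ≤ (4 * m + 2) * b := Nat.mul_le_mul_right _ (by omega)
          _ = 2 * ((2 * m + 1) * b) := by ring
      have key' : (m + 1) * a ≤ (2 * m + 1) * b := Nat.le_of_mul_le_mul_left key (by norm_num)
      nlinarith [key']

/-! ### (1) ⇔ (3) and (2) ⇔ (4): the printed rational forms -/

/-- Estimate (1) of Khare–Wintenberger (I), §7, from its integer form (3):
`(m+1)(P−1) + 2(2m+1) ≤ (2m+1)(p+1)` gives `P/p ≤ (2m+1)/(m+1) − (m/(m+1))·(1/p)` (`p, P ≥ 1`).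
[cite: KhareWintenberger2009, §7, (1) and (3)] -/
theorem ineq1_of_ineq3 {p P m : ℕ} (hp : 1 ≤ p) (hP : 1 ≤ P)
    (h : (m + 1) * (P - 1) + 2 * (2 * m + 1) ≤ (2 * m + 1) * (p + 1)) :
    (P : ℚ) / p ≤ (2 * m + 1) / (m + 1) - m / (m + 1) * (1 / p) := by
  have key : ((m : ℚ) + 1) * P + m ≤ (2 * m + 1) * p := by
    have h' : ((m + 1) * (P - 1) + 2 * (2 * m + 1) : ℕ) ≤ ((2 * m + 1) * (p + 1) : ℕ) := h
    have h'' : (((m + 1) * (P - 1) + 2 * (2 * m + 1) : ℕ) : ℚ) ≤ (((2 * m + 1) * (p + 1) : ℕ) : ℚ) :=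
      by exact_mod_cast h'
    push_cast [Nat.cast_sub hP] at h''
    linarith
  have hp' : (0 : ℚ) < p := by exact_mod_cast hp
  have hm' : (0 : ℚ) < (m : ℚ) + 1 := by positivity
  have hsub : (2 * m + 1 : ℚ) / (m + 1) - m / (m + 1) * (1 / p) - P / p =
      ((2 * m + 1) * p - m - (m + 1) * P) / ((m + 1) * p) := by
    field_simp
  rw [← sub_nonneg, hsub]
  exact div_nonneg (by linarith) (by positivity)

/-- Estimate (3) of Khare–Wintenberger (I), §7, from (1): `P/p ≤ (2m+1)/(m+1) − (m/(m+1))·(1/p)`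
gives `p + 1 ≥ ((m+1)/(2m+1))(P − 1) + 2` (`p ≥ 1`). [cite: KhareWintenberger2009, §7, (1) ⇒ (3)] -/
theorem ineq3_of_ineq1 {p P m : ℕ} (hp : 1 ≤ p)
    (h : (P : ℚ) / p ≤ (2 * m + 1) / (m + 1) - m / (m + 1) * (1 / p)) :
    ((m : ℚ) + 1) / (2 * m + 1) * ((P : ℚ) - 1) + 2 ≤ p + 1 := by
  have hp' : (0 : ℚ) < p := by exact_mod_cast hp
  have hm' : (0 : ℚ) < (m : ℚ) + 1 := by positivity
  have hm'' : (0 : ℚ) < 2 * (m : ℚ) + 1 := by positivity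
  have hsub : (2 * m + 1 : ℚ) / (m + 1) - m / (m + 1) * (1 / p) - P / p =
      ((2 * m + 1) * p - m - (m + 1) * P) / ((m + 1) * p) := by
    field_simp
  rw [← sub_nonneg, hsub] at h
  have key : (0 : ℚ) ≤ (2 * m + 1) * p - m - (m + 1) * P := by
    by_contra hlt
    push Not at hlt
    have := div_neg_of_neg_of_pos hlt (by positivity : (0 : ℚ) < (m + 1) * p)
    linarith
  rw [div_mul_eq_mul_div, div_add' _ _ _ hm''.ne', div_le_iff₀ hm'']
  nlinarith [key]

/-- The identity printed in (3): `((m+1)/(2m+1))(P − 1) + 2 = (P + 1) − (m/(2m+1))(P − 1)`.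
[cite: KhareWintenberger2009, §7, (3)] -/
theorem ineq3_identity (P m : ℚ) (hm : 2 * m + 1 ≠ 0) :
    (m + 1) / (2 * m + 1) * (P - 1) + 2 = (P + 1) - m / (2 * m + 1) * (P - 1) := by
  have h1 : (m + 1) / (2 * m + 1) + m / (2 * m + 1) = (1 : ℚ) := by
    rw [← add_div, show (m : ℚ) + 1 + m = 2 * m + 1 by ring, div_self hm]
  linear_combination (P - 1) * h1

/-- Estimate (2) of Khare–Wintenberger (I), §7, from its integer form (4):
`(2^{r−1}+2)(P−1) + 2^{r+1} ≤ 2^r (p+1)` gives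
`P/p ≤ 2^r/(2^{r−1}+2) − ((2^{r−1}−2)/(2^{r−1}+2))·(1/p)` (`p, P, r ≥ 1`).
[cite: KhareWintenberger2009, §7, (2) and (4)] -/
theorem ineq2_of_ineq4 {p P r : ℕ} (hp : 1 ≤ p) (hP : 1 ≤ P) (hr : 1 ≤ r)
    (h : (2 ^ (r - 1) + 2) * (P - 1) + 2 ^ (r + 1) ≤ 2 ^ r * (p + 1)) :
    (P : ℚ) / p ≤ 2 ^ r / (2 ^ (r - 1) + 2) - (2 ^ (r - 1) - 2) / (2 ^ (r - 1) + 2) * (1 / p) := by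
  obtain ⟨j, rfl⟩ : ∃ j, r = j + 1 := ⟨r - 1, by omega⟩
  simp only [Nat.add_sub_cancel] at h ⊢
  have h2n : 2 ^ (j + 1) = 2 * 2 ^ j := by rw [pow_succ]; ring
  have h4n : 2 ^ (j + 1 + 1) = 4 * 2 ^ j := by rw [pow_succ, pow_succ]; ring
  rw [h2n, h4n] at h
  have hp' : (0 : ℚ) < p := by exact_mod_cast hp
  have key : ((2 : ℚ) ^ j + 2) * P + 2 ^ j - 2 ≤ 2 * 2 ^ j * p := by
    have h'' : (((2 ^ j + 2) * (P - 1) + 4 * 2 ^ j : ℕ) : ℚ) ≤ ((2 * 2 ^ j * (p + 1) : ℕ) : ℚ) := by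
      exact_mod_cast h
    push_cast [Nat.cast_sub hP] at h''
    linarith
  have h2 : (2 : ℚ) ^ (j + 1) = 2 * 2 ^ j := by rw [pow_succ]; ring
  rw [h2]
  have hsub : 2 * (2 : ℚ) ^ j / (2 ^ j + 2) - (2 ^ j - 2) / (2 ^ j + 2) * (1 / p) - P / p =
      (2 * 2 ^ j * p - (2 ^ j - 2) - (2 ^ j + 2) * P) / ((2 ^ j + 2) * p) := by
    field_simp
  rw [← sub_nonneg, hsub]
  exact div_nonneg (by linarith) (by positivity)

/-- Estimate (4) of Khare–Wintenberger (I), §7, from (2):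
`P/p ≤ 2^r/(2^{r−1}+2) − ((2^{r−1}−2)/(2^{r−1}+2))·(1/p)` gives
`p + 1 ≥ ((2^{r−1}+2)/2^r)(P − 1) + 2` (`p, r ≥ 1`). [cite: KhareWintenberger2009, §7, (2) ⇒ (4)] -/
theorem ineq4_of_ineq2 {p P r : ℕ} (hp : 1 ≤ p) (hr : 1 ≤ r)
    (h : (P : ℚ) / p ≤ 2 ^ r / (2 ^ (r - 1) + 2) - (2 ^ (r - 1) - 2) / (2 ^ (r - 1) + 2) * (1 / p)) :
    ((2 : ℚ) ^ (r - 1) + 2) / 2 ^ r * ((P : ℚ) - 1) + 2 ≤ p + 1 := by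
  obtain ⟨j, rfl⟩ : ∃ j, r = j + 1 := ⟨r - 1, by omega⟩
  simp only [Nat.add_sub_cancel] at h ⊢
  have hp' : (0 : ℚ) < p := by exact_mod_cast hp
  have ht0 : (0 : ℚ) < (2 : ℚ) ^ j := by positivity
  have h2 : (2 : ℚ) ^ (j + 1) = 2 * 2 ^ j := by rw [pow_succ]; ring
  rw [h2] at h ⊢
  have hsub : 2 * (2 : ℚ) ^ j / (2 ^ j + 2) - (2 ^ j - 2) / (2 ^ j + 2) * (1 / p) - P / p =
      (2 * 2 ^ j * p - (2 ^ j - 2) - (2 ^ j + 2) * P) / ((2 ^ j + 2) * p) := by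
    field_simp
  rw [← sub_nonneg, hsub] at h
  have key : (0 : ℚ) ≤ 2 * 2 ^ j * p - (2 ^ j - 2) - (2 ^ j + 2) * P := by
    by_contra hlt
    push Not at hlt
    have := div_neg_of_neg_of_pos hlt (by positivity : (0 : ℚ) < (2 ^ j + 2) * p)
    linarith
  have hne : (2 * (2 : ℚ) ^ j) ≠ 0 := by positivity
  rw [div_mul_eq_mul_div, div_add' _ _ _ hne, div_le_iff₀ (by positivity)]
  nlinarith [key, ht0]

/-- The second inequality printed in (4): `((2^{r−1}+2)/2^r)(P − 1) + 2 ≥ (P + 1) − (1/2)(P − 1)`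
for `P ≥ 1`, `r ≥ 1` (as `(2^{r−1}+2)/2^r ≥ 1/2`). [cite: KhareWintenberger2009, §7, (4)] -/
theorem ineq4_weak {r : ℕ} (hr : 1 ≤ r) {P : ℚ} (hP : 1 ≤ P) :
    (P + 1) - 1 / 2 * (P - 1) ≤ ((2 : ℚ) ^ (r - 1) + 2) / 2 ^ r * (P - 1) + 2 := by
  obtain ⟨j, rfl⟩ : ∃ j, r = j + 1 := ⟨r - 1, by omega⟩
  simp only [Nat.add_sub_cancel]
  have ht0 : (0 : ℚ) < (2 : ℚ) ^ j := by positivity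
  have hcoef : (1 : ℚ) / 2 ≤ ((2 : ℚ) ^ j + 2) / 2 ^ (j + 1) := by
    rw [pow_succ, div_le_div_iff₀ (by norm_num) (by positivity)]
    nlinarith
  nlinarith [mul_le_mul_of_nonneg_right hcoef (by linarith : (0 : ℚ) ≤ P - 1)]

/-! ### §7 for the next prime -/

/-- **Khare–Wintenberger (I), §7, integer form (3)/(4), for the next prime.**  For every prime
`p ≥ 5`, letting `P` be the next prime after `p` (the least prime `> p`), either there is an odd
prime `ℓ = 2m + 1` with `ℓ^r ∥ P − 1` (`r ≥ 1`) and `(m+1)(P−1) + 2(2m+1) ≤ (2m+1)(p+1)`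
(estimate (3)), or `2^r ∥ P − 1` with `r ≥ 4` and `(2^{r−1}+2)(P−1) + 2^{r+1} ≤ 2^r (p+1)`
(estimate (4)).  For `p ≠ 7` this is `sec7_of_two_mul_le` (the next prime is `≤ (3p−1)/2`); for
`p = 7`, `P = 11`, `ℓ = 5` gives equality. [cite: KhareWintenberger2009, §7, (3)–(4)] -/
theorem sec7_int {p : ℕ} (hp : p.Prime) (h5 : 5 ≤ p) :
    ∃ P : ℕ, P.Prime ∧ p < P ∧ (∀ q : ℕ, q.Prime → p < q → P ≤ q) ∧
      ((∃ ℓ m r : ℕ, ℓ.Prime ∧ ℓ = 2 * m + 1 ∧ 1 ≤ m ∧ 1 ≤ r ∧ ℓ ^ r ∣ P - 1 ∧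
          ¬ ℓ ^ (r + 1) ∣ P - 1 ∧ (m + 1) * (P - 1) + 2 * (2 * m + 1) ≤ (2 * m + 1) * (p + 1)) ∨
        (∃ r : ℕ, 4 ≤ r ∧ 2 ^ r ∣ P - 1 ∧ ¬ 2 ^ (r + 1) ∣ P - 1 ∧
          (2 ^ (r - 1) + 2) * (P - 1) + 2 ^ (r + 1) ≤ 2 ^ r * (p + 1))) := by
  by_cases h7 : p = 7
  · subst h7
    refine ⟨11, by norm_num, by norm_num, fun q hq h7q => ?_, Or.inl ⟨5, 2, 1, by norm_num, rfl,
      by norm_num, le_rfl, by norm_num, by norm_num, by norm_num⟩⟩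
    by_contra hlt
    push Not at hlt
    interval_cases q <;> exact absurd hq (by norm_num)
  · -- `p = 5` or `p ≥ 8` (as `6` is not prime): the next prime is `≤ (3p−1)/2`.
    have hP : ∃ P : ℕ, P.Prime ∧ p < P ∧ (∀ q : ℕ, q.Prime → p < q → P ≤ q) ∧ 2 * P ≤ 3 * p - 1 := by
      rcases Nat.lt_or_ge p 8 with hlt | hge
      · interval_cases p
        · refine ⟨7, by norm_num, by norm_num, fun q hq h5q => ?_, by norm_num⟩
          by_contra hlt'
          push Not at hlt'
          interval_cases q; exact absurd hq (by norm_num)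
        · exact absurd hp (by norm_num)
        · exact absurd rfl h7
      · exact exists_nextPrime_two_mul_le hge
    obtain ⟨P, hPp, hpP, hmin, hle⟩ := hP
    refine ⟨P, hPp, hpP, hmin, ?_⟩
    rcases sec7_of_two_mul_le h5 hPp hpP hle with h | ⟨r, hr, -, hdvd, hndvd, hineq⟩
    · exact Or.inl h
    · exact Or.inr ⟨r, hr, hdvd, hndvd, hineq⟩

/-- **Khare–Wintenberger (I), §7 "Estimates on primes", as printed.**  For each prime `p ≥ 5`,
with `P` the next prime after `p` (the least prime `> p`), either (i) there is an odd prime power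
divisor `ℓ^r ∥ (P − 1)`, `ℓ = 2m + 1` with `m ≥ 1`, such that
`P/p ≤ (2m+1)/(m+1) − (m/(m+1))(1/p)` (1), or (ii) `2^r ∥ (P − 1)` with `r ≥ 4` such that
`P/p ≤ 2^r/(2^{r−1}+2) − ((2^{r−1}−2)/(2^{r−1}+2))(1/p)` (2); inequalities in `ℚ`.
Khare–Wintenberger check this by hand for `p ≤ 31` and deduce it from Rosser–Schoenfeld for
`p > 31`; here it follows for all `p` from the tree's explicit Chebyshev–Sylvester prime window
(`exists_prime_gt_and_two_mul_le`) via `sec7_int` and `ineq1_of_ineq3` / `ineq2_of_ineq4`.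
[cite: KhareWintenberger2009, §7, (1)–(2)] -/
theorem sec7 {p : ℕ} (hp : p.Prime) (h5 : 5 ≤ p) :
    ∃ P : ℕ, P.Prime ∧ p < P ∧ (∀ q : ℕ, q.Prime → p < q → P ≤ q) ∧
      ((∃ ℓ m r : ℕ, ℓ.Prime ∧ ℓ = 2 * m + 1 ∧ 1 ≤ m ∧ 1 ≤ r ∧ ℓ ^ r ∣ P - 1 ∧
          ¬ ℓ ^ (r + 1) ∣ P - 1 ∧
          (P : ℚ) / p ≤ (2 * m + 1) / (m + 1) - m / (m + 1) * (1 / p)) ∨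
        (∃ r : ℕ, 4 ≤ r ∧ 2 ^ r ∣ P - 1 ∧ ¬ 2 ^ (r + 1) ∣ P - 1 ∧
          (P : ℚ) / p ≤ 2 ^ r / (2 ^ (r - 1) + 2) - (2 ^ (r - 1) - 2) / (2 ^ (r - 1) + 2) * (1 / p))) := by
  obtain ⟨P, hPp, hpP, hmin, h⟩ := sec7_int hp h5
  refine ⟨P, hPp, hpP, hmin, ?_⟩
  have hp1 : 1 ≤ p := by omega
  have hP1 : 1 ≤ P := by omega
  rcases h with ⟨ℓ, m, r, hℓ, hℓm, hm, hr, hdvd, hndvd, hineq⟩ | ⟨r, hr, hdvd, hndvd, hineq⟩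
  · exact Or.inl ⟨ℓ, m, r, hℓ, hℓm, hm, hr, hdvd, hndvd, ineq1_of_ineq3 hp1 hP1 hineq⟩
  · exact Or.inr ⟨r, hr, hdvd, hndvd, ineq2_of_ineq4 hp1 hP1 (by omega) hineq⟩

end Literature.NumberTheory.Automorphic.KhareWintenberger
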